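import Summits.NavierStokesRegularity.FluidComputer.HeadStartSub

/-!
# Tao's delay gate from a SIGNED CLOCK HEAD-START, part 4: the critical-time window
# `2 - 24 log K/M - 27η - h₋² ≤ t_c² + 2h·t_c ≤ 2 + 10/M + 30η` (`h = b₀/ε`) and the quiet phase

Companion file of `HeadStartTransition.lean`, `HeadStartQuiet.lean`, `HeadStartSub.lean` (cell `pub-fluidc`,
blueprint seat bp1; ONE text split by the 400-line rule; namespace
`Summit.NavierStokesRegularity.FluidComputer.HeadStart`). HONEST FRAMING (verbatim): low prior, high
value-of-information experiment on Tao's machine paradigm; NOT a claim that NS blows up. Everything here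
concerns the five-mode truncation (5.5) of [Tao2016AveragedNS, §5.5] in the retuned form
`delayCircuitWith K M ε` with the diagonal damping `-E(t) * X`, `0 ≤ Eᵢ(t) ≤ η`, on `[0,2]`, started in the
signed head-start class `HS±(ε)` of part 1 (explicit hypothesis `h0`; head-start `h := b₀/ε ∈ [-1/5, 2/5]`,
`h₋ := max(-h,0)`); nothing is proved about the Navier–Stokes equations.

* `tc_window` — (tcable)/(c-bound) with a signed head-start: the first hitting time `t_c` of the level
  `K⁻¹⁰ε²` satisfies `2 - 24 log K/M - 27η - h₋² ≤ t_c² + 2h·t_c ≤ 2 + 10/M + 30η`, `1 ≤ t_c ≤ 33/20`,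
  `c(t_c) = K⁻¹⁰ε²` (needs `1250 log K ≤ M ≤ K¹⁰`, `K ≥ 16`, `ε² ≤ 1/(12K²⁰)`, `η ≤ 1/1000`). So a clock
  AHEAD (`h > 0`) advances the transition to `t_c = √(2+h²) - h` up to `O(log K/M + η)` (sharp), and a
  clock BEHIND (`h < 0`) retards it to `t_c ∈ [√(2+h²)+|h| - O(·), √2+|h| + O(·)]` (true value `√2 + |h|`;
  the extra `h²`-slack is the price of not square-completing the sub-solution). For `h = 0` compare
  `DampedTransition.tc_window` (`2 - 24 log K/M - 18η ≤ t_c² ≤ 2 + 2/M + 20η`).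
* `quietPhase` — the quiet-phase portrait on `[0, t_c]` in one statement: `0 ≤ c ≤ K⁻¹⁰ε²`,
  `|a - 1| ≤ 8K⁻²⁰ + 2η`, `|b - (b₀ + εt)| ≤ θεt`, `|d|, |ã| ≤ 3K⁻¹⁰`; `able_window` — (able) with the
  constant `200` (+ `2η` on `a`) on all of `[0, t_c]`.

[cite: Tao2016AveragedNS, §5.5 Thm 5.3, (tcable), (c-bound), proof pp. 28–30]
-/

noncomputable section

namespace Summit.NavierStokesRegularity.FluidComputer

open Real Set Filter Topology
open Literature.Analysis.FluidPDE.Tao2016AveragedNS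
open Literature.Analysis.FluidPDE.Tao2016AveragedNS.Thm53 (antitoneOn_intFactor monotoneOn_intFactor
  antitoneOn_sub_of_deriv_le monotoneOn_sub_of_le_deriv abs_sub_le_of_abs_deriv_le)
open Literature.Analysis.FluidPDE.Tao2016AveragedNS.Thm53With (log_facts)
open DampedTransition (hasDerivAt_a hasDerivAt_b hasDerivAt_c hasDerivAt_d hasDerivAt_e
  exists_hitTime_on continuousOn_traj)

namespace HeadStart

section CriticalTime

variable {K M ε η τ : ℝ} {E X : ℝ → Fin 5 → ℝ}

set_option maxHeartbeats 400000 in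
/-- **(tcable) and (c-bound) with a signed clock head-start `h = b₀/ε ∈ [-1/5, 2/5]`, damping
`η ≤ 1/1000`.** If `τ` is the first hitting time of the level `K⁻¹⁰ε²` by `c` on `[0,2]`, then
`2 - 24 log K / M - 27η - h₋² ≤ τ² + 2hτ ≤ 2 + 10/M + 30η` (`h₋ := max(-h,0)`), `1 ≤ τ ≤ 33/20` (using
`1250 log K ≤ M`) and `c(τ) = K⁻¹⁰ε²`. Lower edge: the square-completed super-solution of part 2 at the
hitting time (`K⁻¹⁰ ≤ 2e^{(1+θ)Mτ²/2 + Mhτ + Mh₋²/(2(1+θ)) - M}`, then `log`); upper edge: the sub-solution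
of part 3 at the root `T` of `T² + 2hT = 2 + 10/M + 30η`, where its exponent is already `≥ 4 > log 12`.
For `h ≥ 0` both edges are sharp (`t_c = √(2+h²) - h`, cf. `DampedTransition.tc_window` for `h = 0`);
for `h < 0` the true centre is `τ² + 2hτ = 2 - h²` (`t_c = √2 + |h|`: the seed that matters is laid at the
clock's zero `t = |h|`), which this window contains but does not pin down, because the sub-solution of
part 3 is not square-completed.
[cite: Tao2016AveragedNS, §5.5 (tcable), (c-bound)] -/
theorem tc_window
    (hX : ∀ t ∈ Icc (0:ℝ) 2, HasDerivAt X (delayCircuitWith K M ε (X t) - E t * X t) t)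
    (hE : ∀ t ∈ Icc (0:ℝ) 2, ∀ i, 0 ≤ E t i ∧ E t i ≤ η)
    (h0 : X 0 0 ^ 2 + X 0 1 ^ 2 = 1 ∧ 0 ≤ X 0 0 ∧ -(1 / 5 * ε) ≤ X 0 1 ∧ X 0 1 ≤ 2 / 5 * ε ∧ X 0 2 = 0 ∧ X 0 3 = 0 ∧ X 0 4 = 0)
    (hε : 0 < ε) (hε1 : ε ≤ 1) (hM0 : 0 < M) (hMK : M ≤ K ^ 10) (hK : 16 ≤ K)
    (hML : 1250 * Real.log K ≤ M) (hεK : ε ^ 2 ≤ 1 / (12 * K ^ 20)) (hη : η ≤ 1 / 1000)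
    (hτ0 : 0 < τ) (hτ2 : τ ≤ 2)
    (hcτ : ∀ t, 0 ≤ t → t ≤ τ → X t 2 ≤ ε ^ 2 / K ^ 10)
    (hτeq : τ < 2 → X τ 2 = ε ^ 2 / K ^ 10) :
    2 - 24 * Real.log K / M - 27 * η - (max (-(X 0 1 / ε)) 0) ^ 2 ≤ τ ^ 2 + 2 * (X 0 1 / ε) * τ ∧
      τ ^ 2 + 2 * (X 0 1 / ε) * τ ≤ 2 + 10 / M + 30 * η ∧ 1 ≤ τ ∧ τ ≤ 33 / 20 ∧
      X τ 2 = ε ^ 2 / K ^ 10 := by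
  have hK2 : 2 ≤ K := by linarith
  have hK1 : 1 ≤ K := by linarith
  have hK0 : 0 < K := by linarith
  have hη0 : 0 ≤ η := (hE 0 ⟨le_rfl, zero_le_two⟩ 0).1.trans (hE 0 ⟨le_rfl, zero_le_two⟩ 0).2
  have hη10 : η ≤ 1 / 10 := by linarith
  obtain ⟨hlog, hlog2, hlog0⟩ := log_facts hK
  have hM2500 : 2500 ≤ M := by linarith
  have h10M : 10 / M ≤ 1 / 250 := by rw [div_le_div_iff₀ hM0 (by norm_num)]; linarith
  have hK10 : (16 : ℝ) ^ 10 ≤ K ^ 10 := pow_le_pow_left₀ (by norm_num) hK 10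
  have hK10p : 0 < K ^ 10 := by positivity
  have hK20 : K ^ 20 = K ^ 10 * K ^ 10 := by ring
  have hK20ge : (16 : ℝ) ^ 10 * 16 ^ 10 ≤ K ^ 10 * K ^ 10 :=
    mul_le_mul hK10 hK10 (by positivity) (by positivity)
  obtain ⟨θ, hθ⟩ : ∃ θ : ℝ, θ = 17 / K ^ 20 + 9 * η := ⟨_, rfl⟩
  have hθ0 : 0 ≤ θ := by rw [hθ]; positivity
  have h17 : 17 / K ^ 20 ≤ 1 / 1100 := by
    rw [div_le_div_iff₀ (by positivity) (by norm_num), hK20]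
    norm_num at hK20ge ⊢
    linarith
  have hθ11 : θ ≤ 1 / 11 := by rw [hθ]; linarith
  -- the signed head-start `hh = b₀/ε ∈ [-1/5, 2/5]`, its negative part `q`; `ε⁻¹ M b₀ t = M hh t`
  set hh : ℝ := X 0 1 / ε with hhh
  have hh5 : -(1 / 5) ≤ hh := by rw [hhh, le_div_iff₀ hε]; linarith [h0.2.2.1]
  have hh25 : hh ≤ 2 / 5 := by rw [hhh, div_le_iff₀ hε]; exact h0.2.2.2.1
  set q : ℝ := max (-hh) 0 with hq
  have hq5 : q ≤ 1 / 5 := max_le (by linarith) (by norm_num)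
  have hqsq : q ^ 2 ≤ 1 / 25 := by nlinarith [le_max_right (-hh) 0]
  have hνt : ∀ t : ℝ, ε⁻¹ * M * X 0 1 * t = M * hh * t := fun t => by
    simp only [hhh]; field_simp
  have hhτlo : -(4 / 5) ≤ 2 * hh * τ := by
    have : 2 * (-(1 / 5)) * τ ≤ 2 * hh * τ := mul_le_mul_of_nonneg_right (by linarith) hτ0.le
    linarith
  have hhτhi : 2 * hh * τ ≤ 4 / 5 * τ := by
    have : 2 * hh * τ ≤ 2 * (2 / 5) * τ := mul_le_mul_of_nonneg_right (by linarith) hτ0.le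
    linarith
  -- late side: `τ² + 2 hh τ ≤ 2 + 10/M + 30η`
  have hlate : τ ^ 2 + 2 * hh * τ ≤ 2 + 10 / M + 30 * η := by
    by_contra hlt'
    have hlt := not_le.1 hlt'
    set U : ℝ := 2 + 10 / M + 30 * η with hU
    have hU2 : 2 ≤ U := by
      have h10 : (0:ℝ) ≤ 10 / M := by positivity
      simp only [hU]; linarith
    have hU3 : U ≤ 3 := by simp only [hU]; linarith
    -- the root `T = √(U + hh²) - hh` of `T² + 2 hh T = U`; `1 ≤ T ≤ 2`, `T < τ`
    set T : ℝ := sqrt (U + hh ^ 2) - hh with hT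
    have hsq : sqrt (U + hh ^ 2) ^ 2 = U + hh ^ 2 := sq_sqrt (by positivity)
    have hTU : T ^ 2 + 2 * hh * T = U := by
      have e : T ^ 2 + 2 * hh * T = sqrt (U + hh ^ 2) ^ 2 - hh ^ 2 := by simp only [hT]; ring
      rw [e, hsq]; ring
    have hT0 : 0 ≤ T := by
      simp only [hT]; rw [sub_nonneg]
      calc hh ≤ |hh| := le_abs_self hh
        _ = sqrt (hh ^ 2) := (sqrt_sq_eq_abs hh).symm
        _ ≤ sqrt (U + hh ^ 2) := sqrt_le_sqrt (by linarith)
    have hT1 : 1 ≤ T := by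
      by_contra hlt1
      have hlt1' : T < 1 := not_le.1 hlt1
      have hTT : T ^ 2 ≤ T :=
        calc T ^ 2 = T * T := sq T
          _ ≤ T * 1 := mul_le_mul_of_nonneg_left hlt1'.le hT0
          _ = T := mul_one T
      have hhT : 2 * hh * T ≤ 2 * (2 / 5) * T := mul_le_mul_of_nonneg_right (by linarith) hT0
      linarith
    have hTle2 : T ≤ 2 := by
      by_contra hlt2
      have hle2 : 2 ≤ T := (not_le.1 hlt2).le
      have h1 : 2 * (T + 2 * hh) ≤ T * (T + 2 * hh) := mul_le_mul_of_nonneg_right hle2 (by linarith)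
      have e : T * (T + 2 * hh) = T ^ 2 + 2 * hh * T := by ring
      linarith
    have hTτ : T < τ := by
      by_contra hle
      have hle' : τ ≤ T := not_lt.1 hle
      have hprod : 0 ≤ (T - τ) * (T + τ + 2 * hh) := mul_nonneg (sub_nonneg.2 hle') (by linarith)
      have e : (T - τ) * (T + τ + 2 * hh) = (T ^ 2 + 2 * hh * T) - (τ ^ 2 + 2 * hh * τ) := by ring
      rw [e] at hprod
      linarith
    have hT5 : 1 / (2 * (K ^ 5 + M)) ≤ T := by
      have : 1 / (2 * (K ^ 5 + M)) ≤ 1 := by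
        rw [div_le_one (by positivity)]; have := pow_pos hK0 5; linarith
      linarith
    have hτ5 : 1 / (2 * (K ^ 5 + M)) ≤ τ := by linarith
    have hlow := c_lower_sharp hX hE h0 hε hε1 hM0 hMK hK2 hη10 hτ2 hτ5 hεK hcτ (t := T) ⟨hT5, hTτ.le⟩
    rw [← hθ, hνt T] at hlow
    have hcT : X T 2 ≤ ε ^ 2 / K ^ 10 := hcτ T (by linarith) hTτ.le
    -- the exponent at `T` is `≥ 4`: it equals `5 - 5θ - 2η - 17M/K²⁰ + Mη(6 - 15θ) + θ M hh T`
    have hexp4 : 4 ≤ (1 - θ) * M * T ^ 2 / 2 + M * hh * T - 2 * η - M := by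
      have hT2 : T ^ 2 = U - 2 * hh * T := by linarith
      rw [hT2]
      have hexpand : (1 - θ) * M * (U - 2 * hh * T) / 2 + M * hh * T - 2 * η - M
          = 5 - 5 * θ - 2 * η - 17 * M / K ^ 20 + 6 * (M * η) - 15 * (M * η * θ)
            + θ * M * (hh * T) := by
        rw [hU, hθ]
        field_simp
        ring
      rw [hexpand]
      have h1 : 17 * M / K ^ 20 ≤ 17 / K ^ 10 := by
        rw [div_le_div_iff₀ (by positivity) hK10p, hK20]
        have := mul_le_mul_of_nonneg_left hMK (by positivity : (0:ℝ) ≤ 17 * K ^ 10)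
        linarith
      have h2 : 17 / K ^ 10 ≤ 1 / 100 := by
        rw [div_le_div_iff₀ hK10p (by norm_num)]
        norm_num at hK10 ⊢
        linarith
      have hA : -(2 / 5) ≤ hh * T := by
        have : -(1 / 5) * T ≤ hh * T := mul_le_mul_of_nonneg_right hh5 hT0
        linarith
      have hC : θ * M * (-(2 / 5)) ≤ θ * M * (hh * T) :=
        mul_le_mul_of_nonneg_left hA (by have := hM0.le; positivity)
      have eθM : θ * M = 17 * M / K ^ 20 + 9 * (M * η) := by rw [hθ]; ring
      have hD : M * η * (15 * θ) ≤ M * η * (12 / 5) :=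
        mul_le_mul_of_nonneg_left (by linarith) (by have := hM0.le; positivity)
      have hMη : 0 ≤ M * η := by have := hM0.le; positivity
      linarith
    have hexp13 : 13 ≤ exp ((1 - θ) * M * T ^ 2 / 2 + M * hh * T - 2 * η - M) := by
      have hq := Real.quadratic_le_exp_of_nonneg (by norm_num : (0:ℝ) ≤ 4)
      have hm := exp_le_exp.2 hexp4
      norm_num at hq
      linarith
    have h : ε ^ 2 / (12 * K ^ 10) * 13 ≤ ε ^ 2 / K ^ 10 :=
      le_trans (mul_le_mul_of_nonneg_left hexp13 (by positivity)) (hlow.trans hcT)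
    have hpos : 0 < ε ^ 2 / K ^ 10 := by positivity
    have e : ε ^ 2 / (12 * K ^ 10) * 13 = 13 / 12 * (ε ^ 2 / K ^ 10) := by ring
    rw [e] at h
    linarith
  have hU' : 2 + 10 / M + 30 * η ≤ 51 / 25 := by linarith
  have hτ33 : τ ≤ 33 / 20 := by
    by_contra hlt
    have hge : 33 / 20 ≤ τ := (not_le.1 hlt).le
    have h54 : 5 / 4 < τ + 2 * hh := by linarith
    have h1 : 33 / 20 * (τ + 2 * hh) ≤ τ * (τ + 2 * hh) := mul_le_mul_of_nonneg_right hge (by linarith)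
    have h2 : 33 / 20 * (5 / 4) < 33 / 20 * (τ + 2 * hh) := mul_lt_mul_of_pos_left h54 (by norm_num)
    have e : τ * (τ + 2 * hh) = τ ^ 2 + 2 * hh * τ := by ring
    linarith
  have hτlt2 : τ < 2 := by linarith
  have hcτeq := hτeq hτlt2
  -- early side: `2 - 24 log K / M - 27η - q² ≤ τ² + 2 hh τ`
  have hearly : 2 - 24 * Real.log K / M - 27 * η - q ^ 2 ≤ τ ^ 2 + 2 * hh * τ := by
    have hup := c_upper_sharp hX hE h0 hε hε1 hM0 hMK hK1 hτ2 hεK hcτ (t := τ) ⟨hτ0.le, le_rfl⟩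
    rw [hcτeq, ← hθ, hνt τ, ← hhh, ← hq] at hup
    have h1θ : (0:ℝ) < 1 + θ := by linarith
    set ex : ℝ := (1 + θ) * M * τ ^ 2 / 2 + M * hh * τ + M * q ^ 2 / (2 * (1 + θ)) - M with hex
    -- `1/(2K¹⁰) ≤ exp ex`
    have h1 : 1 / (2 * K ^ 10) ≤ exp ex := by
      rw [div_le_iff₀ (by positivity)]
      have hε2 : 0 < ε ^ 2 := by positivity
      have : ε ^ 2 * 1 ≤ ε ^ 2 * (exp ex * (2 * K ^ 10)) := by
        calc ε ^ 2 * 1 = ε ^ 2 / K ^ 10 * K ^ 10 := by field_simp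
          _ ≤ 2 * ε ^ 2 * exp ex * K ^ 10 := mul_le_mul_of_nonneg_right hup (by positivity)
          _ = ε ^ 2 * (exp ex * (2 * K ^ 10)) := by ring
      exact le_of_mul_le_mul_left this hε2
    have h2 : Real.log (1 / (2 * K ^ 10)) ≤ ex := by
      have := Real.log_le_log (by positivity) h1
      rwa [Real.log_exp] at this
    have h3 : Real.log (1 / (2 * K ^ 10)) = -(Real.log 2 + 10 * Real.log K) := by
      rw [one_div, Real.log_inv, Real.log_mul (by norm_num) (by positivity), Real.log_pow]
      push_cast; ring
    rw [h3, hex] at h2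
    -- `M q²/(2(1+θ)) ≤ M q²/2`, so `2M - (1+θ)Mτ² - 2 M hh τ - M q² ≤ 2 log 2 + 20 log K ≤ 22 log K`
    have hr : M * q ^ 2 / (2 * (1 + θ)) ≤ M * q ^ 2 / 2 :=
      div_le_div_of_nonneg_left (by have := hM0.le; positivity) (by norm_num) (by linarith)
    have h4 : 2 * M - (1 + θ) * M * τ ^ 2 - 2 * (M * hh * τ) - M * q ^ 2 ≤ 22 * Real.log K := by
      linarith
    have h5 : 2 - 22 * Real.log K / M - q ^ 2 ≤ (1 + θ) * τ ^ 2 + 2 * hh * τ := by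
      have : 2 - (1 + θ) * τ ^ 2 - 2 * hh * τ - q ^ 2 ≤ 22 * Real.log K / M := by
        rw [le_div_iff₀ hM0]
        have : (2 - (1 + θ) * τ ^ 2 - 2 * hh * τ - q ^ 2) * M
            = 2 * M - (1 + θ) * M * τ ^ 2 - 2 * (M * hh * τ) - M * q ^ 2 := by ring
        linarith
      linarith
    -- `P = τ² + 2 hh τ`: `(1+θ)P = (1+θ)τ² + 2hhτ + θ(2hhτ) ≥ 2 - 22 log K/M - q² - (4/5)θ`, and
    -- `θ P ≤ (51/25) θ` by the late side, so `P = (1+θ)P - θP ≥ 2 - 22 log K/M - q² - 3θ`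
    have hθlo : θ * (-(4 / 5)) ≤ θ * (2 * hh * τ) := mul_le_mul_of_nonneg_left hhτlo hθ0
    have hθP : θ * (τ ^ 2 + 2 * hh * τ) ≤ θ * (51 / 25) := mul_le_mul_of_nonneg_left (hlate.trans hU') hθ0
    have e1 : (1 + θ) * τ ^ 2 + 2 * hh * τ + θ * (2 * hh * τ) - θ * (τ ^ 2 + 2 * hh * τ)
        = τ ^ 2 + 2 * hh * τ := by ring
    have h7 : 2 - 22 * Real.log K / M - q ^ 2 - 3 * θ ≤ τ ^ 2 + 2 * hh * τ := by linarith
    -- `3θ = 51/K²⁰ + 27η` and `51/K²⁰ ≤ 2 log K / M`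
    have h51 : 51 / K ^ 20 ≤ 2 * Real.log K / M := by
      rw [div_le_div_iff₀ (by positivity) hM0]
      have e1 : 51 * M ≤ 51 * K ^ 10 := by linarith
      have e2 : 51 * K ^ 10 ≤ 4 * K ^ 20 := by
        have h51' : (51 : ℝ) ≤ 4 * K ^ 10 := by norm_num at hK10; linarith
        calc 51 * K ^ 10 ≤ 4 * K ^ 10 * K ^ 10 := mul_le_mul_of_nonneg_right h51' hK10p.le
          _ = 4 * K ^ 20 := by ring
      have e3 : 4 * K ^ 20 ≤ 2 * Real.log K * K ^ 20 :=
        mul_le_mul_of_nonneg_right (by linarith) (pow_pos hK0 20).le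
      linarith
    have h3θ : 3 * θ = 51 / K ^ 20 + 27 * η := by rw [hθ]; ring
    have h8 : 22 * Real.log K / M + 2 * Real.log K / M = 24 * Real.log K / M := by ring
    linarith
  have hτ1 : 1 ≤ τ := by
    have h24 : 24 * Real.log K / M ≤ 1 / 52 := by
      rw [div_le_div_iff₀ hM0 (by norm_num)]; linarith
    by_contra hlt1
    have hlt1' : τ < 1 := not_le.1 hlt1
    have hττ : τ ^ 2 ≤ τ :=
      calc τ ^ 2 = τ * τ := sq τ
        _ ≤ τ * 1 := mul_le_mul_of_nonneg_left hlt1'.le hτ0.le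
        _ = τ := mul_one τ
    linarith
  exact ⟨hearly, hlate, hτ1, hτ33, hcτeq⟩

/-- **THE QUIET PHASE FROM A SIGNED CLOCK HEAD-START `h = b₀/ε ∈ [-1/5, 2/5]`, damping `η ≤ 1/1000`.**
For every damping profile `0 ≤ Eᵢ(t) ≤ η ≤ 1/1000` on `[0,2]` and every trajectory of
`Ẋ = delayCircuitWith K M ε X - E(t) * X` on `[0,2]` started in the class `HS±(ε)` (`1250 log K ≤ M ≤ K¹⁰`,
`K ≥ 16`, `ε² ≤ 1/(12K²⁰)`): there is a critical time `t_c` with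
`2 - 24 log K/M - 27η - h₋² ≤ t_c² + 2h·t_c ≤ 2 + 10/M + 30η` (`h₋ = max(-h,0)`; `1 ≤ t_c ≤ 33/20`), at
which `c(t_c) = K⁻¹⁰ε²`, and on `[0,t_c]` the gate is quiet: `0 ≤ c ≤ K⁻¹⁰ε²`, `|a - 1| ≤ 8K⁻²⁰ + 2η`,
`|b - (b₀ + εt)| ≤ (17K⁻²⁰ + 9η)εt`, `|d|, |ã| ≤ 3K⁻¹⁰`. (`h = 0`: `DampedTransition.quietPhase`.)
[cite: Tao2016AveragedNS, §5.5 Thm 5.3, (tcable), (c-bound)] -/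
theorem quietPhase
    (hX : ∀ t ∈ Icc (0:ℝ) 2, HasDerivAt X (delayCircuitWith K M ε (X t) - E t * X t) t)
    (hE : ∀ t ∈ Icc (0:ℝ) 2, ∀ i, 0 ≤ E t i ∧ E t i ≤ η)
    (h0 : X 0 0 ^ 2 + X 0 1 ^ 2 = 1 ∧ 0 ≤ X 0 0 ∧ -(1 / 5 * ε) ≤ X 0 1 ∧ X 0 1 ≤ 2 / 5 * ε ∧ X 0 2 = 0 ∧ X 0 3 = 0 ∧ X 0 4 = 0)
    (hε : 0 < ε) (hε1 : ε ≤ 1) (hM0 : 0 < M) (hMK : M ≤ K ^ 10) (hK : 16 ≤ K)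
    (hML : 1250 * Real.log K ≤ M) (hεK : ε ^ 2 ≤ 1 / (12 * K ^ 20)) (hη : η ≤ 1 / 1000) :
    ∃ τ : ℝ, (2 - 24 * Real.log K / M - 27 * η - (max (-(X 0 1 / ε)) 0) ^ 2 ≤ τ ^ 2 + 2 * (X 0 1 / ε) * τ ∧
        τ ^ 2 + 2 * (X 0 1 / ε) * τ ≤ 2 + 10 / M + 30 * η ∧ 1 ≤ τ ∧ τ ≤ 33 / 20) ∧
      X τ 2 = ε ^ 2 / K ^ 10 ∧
      ∀ t ∈ Icc 0 τ, (0 ≤ X t 2 ∧ X t 2 ≤ ε ^ 2 / K ^ 10) ∧ |X t 0 - 1| ≤ 8 / K ^ 20 + 2 * η ∧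
        |X t 1 - (X 0 1 + ε * t)| ≤ (17 / K ^ 20 + 9 * η) * ε * t ∧
        |X t 3| ≤ 3 / K ^ 10 ∧ |X t 4| ≤ 3 / K ^ 10 := by
  have hK0 : 0 < K := by linarith
  have hK1 : 1 ≤ K := by linarith
  have hlev : X 0 2 < ε ^ 2 / K ^ 10 := by rw [h0.2.2.2.2.1]; positivity
  obtain ⟨τ, hτ0, hτ2, hcτ, hτeq⟩ :=
    exists_hitTime_on (θ := ε ^ 2 / K ^ 10) two_pos (continuousOn_traj hX 2) hlev
  obtain ⟨hlo, hhi, hτ1, hτ32, hceq⟩ :=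
    tc_window hX hE h0 hε hε1 hM0 hMK hK hML hεK hη hτ0 hτ2 hcτ hτeq
  refine ⟨τ, ⟨hlo, hhi, hτ1, hτ32⟩, hceq, fun t ht => ⟨⟨?_, hcτ t ht.1 ht.2⟩, ?_, ?_, ?_⟩⟩
  · exact c_nonneg hX hE h0 hε hε1 hM0.le ⟨ht.1, ht.2.trans hτ2⟩
  · exact a_window hX hE h0 hε hε1 hM0.le hK0 hτ2 hεK hcτ ht
  · exact b_window hX hE h0 hε hε1 hM0 hMK hK1 hτ2 hεK hcτ ht
  · exact de_small hX hE h0 hε hε1 hM0.le hK0 hτ2 hcτ ht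

/-- (able) with constant `200` (+ `2η` on `a`), on all of `[0, t_c]`.
[cite: Tao2016AveragedNS, §5.5 (able2)] -/
theorem able_window
    (hX : ∀ t ∈ Icc (0:ℝ) 2, HasDerivAt X (delayCircuitWith K M ε (X t) - E t * X t) t)
    (hE : ∀ t ∈ Icc (0:ℝ) 2, ∀ i, 0 ≤ E t i ∧ E t i ≤ η)
    (h0 : X 0 0 ^ 2 + X 0 1 ^ 2 = 1 ∧ 0 ≤ X 0 0 ∧ -(1 / 5 * ε) ≤ X 0 1 ∧ X 0 1 ≤ 2 / 5 * ε ∧ X 0 2 = 0 ∧ X 0 3 = 0 ∧ X 0 4 = 0)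
    (hε : 0 < ε) (hε1 : ε ≤ 1) (hM0 : 0 ≤ M) (hK : 16 ≤ K) (hεK : ε ^ 2 ≤ 1 / (12 * K ^ 20))
    (hε100 : ε ≤ 1 / K ^ 100) (hτ2 : τ ≤ 2)
    (hcτ : ∀ t, 0 ≤ t → t ≤ τ → X t 2 ≤ ε ^ 2 / K ^ 10)
    {t : ℝ} (ht : t ∈ Icc 0 τ) :
    |X t 0 - 1| ≤ 200 / K ^ 10 + 2 * η ∧ ∀ i : Fin 5, i ≠ 0 → |X t i| ≤ 200 / K ^ 10 := by
  have hK0 : 0 < K := by linarith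
  have hK1 : 1 ≤ K := by linarith
  have ht2 : t ∈ Icc (0 : ℝ) 2 := ⟨ht.1, ht.2.trans hτ2⟩
  have ha := a_window hX hE h0 hε hε1 hM0 hK0 hτ2 hεK hcτ ht
  obtain ⟨hb, hc⟩ := bc_small hX hE h0 hε hε1 hM0 ht2
  obtain ⟨hd, he⟩ := de_small hX hE h0 hε hε1 hM0 hK0 hτ2 hcτ ht
  have h20 : 8 / K ^ 20 ≤ 200 / K ^ 10 := by
    calc 8 / K ^ 20 ≤ 8 / K ^ 10 := by
          apply div_le_div_of_nonneg_left (by norm_num) (by positivity)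
          exact pow_le_pow_right₀ hK1 (by norm_num)
      _ ≤ 200 / K ^ 10 := div_le_div_of_nonneg_right (by norm_num) (by positivity)
  have h5 : 5 * ε ≤ 200 / K ^ 10 := by
    have h1 : 1 / K ^ 100 ≤ 1 / K ^ 10 := by
      apply div_le_div_of_nonneg_left (by norm_num) (by positivity)
      exact pow_le_pow_right₀ hK1 (by norm_num)
    have h2 : 5 * (1 / K ^ 10) ≤ 200 / K ^ 10 := by
      rw [mul_one_div]; exact div_le_div_of_nonneg_right (by norm_num) (by positivity)
    linarith
  have h3 : 3 / K ^ 10 ≤ 200 / K ^ 10 := div_le_div_of_nonneg_right (by norm_num) (by positivity)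
  have hb' := hb.trans h5
  have hc' := hc.trans h5
  have hd' := hd.trans h3
  have he' := he.trans h3
  refine ⟨by linarith, ?_⟩
  intro i hi
  fin_cases i
  · exact absurd rfl hi
  · exact hb'
  · exact hc'
  · exact hd'
  · exact he'

end CriticalTime

end HeadStart

end Summit.NavierStokesRegularity.FluidComputer
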